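import Literature.AnabelianGeometry.SemiGraphs.TemperedPiLevelDataCptOfTower
import Literature.AnabelianGeometry.SemiGraphs.TemperedPiVerticialLevelData
import Literature.AnabelianGeometry.SemiGraphs.TemperedPiLevelsConnected
import Literature.AnabelianGeometry.SemiGraphs.TemperedBranchPairOfTower
import Literature.AnabelianGeometry.SemiGraphs.TemperedPiDeckCompact
import Literature.AnabelianGeometry.SemiGraphs.TemperedCompactInVerticialCpt
import Literature.AnabelianGeometry.SemiGraphs.TemperedPiFibreFaithful
import Literature.AnabelianGeometry.SemiGraphs.TemperedThm37OfCompactInVerticialAt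
import HarnessLib

/-!
# [SemiAnbd] Theorem 3.7 (iii) for finite `𝔾`: the tempered fundamental group's finite-level data, assembled

Mochizuki, *Semi-graphs of anabelioids*, Publ. RIMS **42** (2006) [MochizukiSemiAnbd2006], Thm. 3.7 (iii)
pp. 40–41 ("Every compact subgroup of `π₁^temp(𝒢)` is contained in at least one verticial subgroup. If a
nontrivial compact subgroup … is contained in more than one verticial subgroup, then it is contained in
precisely two … this compact subgroup is contained in the image of some `π̂₁(𝒢_e)`"), proof p. 41 with the
author's *Comments* (2020) item (6); finiteness of the underlying semi-graph `𝔾` as on p. 41 ("Since the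
semi-graphs `𝔾_j` are all finite").

FINAL ASSEMBLY of the cell's row (β) (seat abc-iut-L3-t8 gen 4, row (β)-ASM), no new mathematics: for `𝒢`
satisfying the hypotheses of Thm. 3.7 with FINITE `𝔾`, the tempered fundamental group chart of Prop. 3.6
(`𝒢.temperedPiChart`, seat abc-iut-L3-t9) carries compact-form finite-level data `FiniteLevelDataCpt`
(v4, seat abc-iut-L3-t6): the Galois tower `𝒢.galoisLevelData` with its trees and finite levels
(`finiteLevelDataCptOfTower`, ASM-1), the identifications (I1)–(I3) (`fix_/stab_/edge_temperedPiChart`,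
`TemperedPiVerticialLevelData.lean`) and (I4′)_cpt (seat abc-iut-L3-t11's core
`stabBranchPairCpt'_ofTower`, fed with seat abc-iut-L3-t6's injectivity-on-compacts
`injOn_of_isCompact_of_ker_le` and the faithfulness of `Π_v` on the tower's vertex fibres (I0v)); by the
compact-form consumer chain (seat abc-iut-w4-d064: chart transport + `FiniteLevelDataCpt.compactInVerticial`,
over seats abc-iut-L3-t10/t11's reductions and Thm. 3.7 (i)/(ii) `verticialInjective_holds` /
`verticialDistinct_holds`) this yields `CompactInVerticialAt 𝒢` — Thm. 3.7 (iii) at every finite `𝔾`, for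
EVERY chart (`compactInVerticialAt_of_finiteGraph`) — and with it Thm. 3.7 (iv) and the edge-like residuals at
every finite `𝔾` (seat abc-iut-L3-t11's `TemperedThm37OfCompactInVerticialAt.lean`).  Nothing here bears on [IUTchIII] Cor. 3.12.
-/

namespace Literature.AnabelianGeometry.SemiGraphs

namespace ProfiniteSemiGraph

open CategoryTheory Topology

universe u

variable (𝒢 : ProfiniteSemiGraph.{u}) (h36 : 𝒢.Prop36Hypotheses)

/-- **(I0c) for the constructed chart**: the level completion `π₁^temp(𝒢) → ∏ₙ Gal(S n/𝒢)` is injective on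
every COMPACT subgroup (the deck kernel meets compact subgroups trivially: a compact group of deck
transformations of a tree fixes a vertex, hence is trivial — seat abc-iut-L3-t6's `injOn_of_isCompact_of_ker_le`).
[cite: MochizukiSemiAnbd2006, Thm 3.7(iii) p.41] -/
theorem injOn_toLevelGal_temperedPiChart (C : Subgroup (𝒢.temperedPiChart h36).G)
    (hC : IsCompact (C : Set (𝒢.temperedPiChart h36).G)) :
    Set.InjOn ((𝒢.galoisLevelData h36).toLevelGal h36.isCountable (𝒢.galoisLevelData_hconn h36)
      (𝒢.temperedPiChart h36) (MonoidHom.id _)) C :=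
  (𝒢.galoisLevelData h36).injOn_of_isCompact_of_ker_le h36.isCountable (𝒢.galoisLevelData_hconn h36) _
    (fun g hg n => by
      have h := congrFun hg n
      exact h) C hC

/-- **(I4′)_cpt for the constructed chart**, in the binder shape of `finiteLevelDataCptOfTower` at
`D := 𝒢.galoisLevelData h36`, `c := 𝒢.temperedPiChart h36`, `ρ := id`: seat abc-iut-L3-t11's core with (I0c)
above and (I0v) (faithfulness of `Π_v` on the tower's vertex fibres) as input.
[cite: MochizukiSemiAnbd2006, Thm 3.7(iii) p.41] -/
theorem stabBranchPairCpt'_temperedPiChart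
    (hfaithV : ∀ (v : 𝒢.graph.Vertex) (h : 𝒢.Gv v),
      (∀ (n : ℕ) (x : (((𝒢.galoisLevelData h36).S n).SV v).obj.V),
        (((𝒢.galoisLevelData h36).S n).SV v).obj.ρ h x = x) → h = 1)
    (C : Subgroup (𝒢.temperedPiChart h36).G) (hC : IsCompact (C : Set (𝒢.temperedPiChart h36).G))
    (j₀ : ℕ) (w : ∀ i : {i : ℕ // j₀ ≤ i}, ((𝒢.galoisLevelData h36).S i.1).orbitGraph.Vertex)
    (β β' : ∀ i : {i : ℕ // j₀ ≤ i}, ((𝒢.galoisLevelData h36).S i.1).orbitGraph.Branch)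
    (hpair : ∀ i, β i ≠ β' i ∧ ((𝒢.galoisLevelData h36).S i.1).orbitGraph.abuts (β i) = some (w i) ∧
      ((𝒢.galoisLevelData h36).S i.1).orbitGraph.abuts (β' i) = some (w i))
    (hcompat : ∀ ⦃i i' : {i : ℕ // j₀ ≤ i}⦄ (h : i.1 ≤ i'.1),
      ((𝒢.galoisLevelData h36).levelTrans h).vertexMap (w i') = w i ∧
      ((𝒢.galoisLevelData h36).levelTrans h).branchMap (β i') = β i ∧
      ((𝒢.galoisLevelData h36).levelTrans h).branchMap (β' i') = β' i) :
    ∃ (Q : Type u) (_ : Group Q) (ιQ : (𝒢.temperedPiChart h36).G →* Q) (v : 𝒢.graph.Vertex)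
      (b b' : 𝒢.graph.Branch) (hb : 𝒢.graph.abuts b = some v) (hb' : 𝒢.graph.abuts b' = some v)
      (ψ : 𝒢.Gv v →* Q) (x x' : 𝒢.Gv v),
      Set.InjOn ιQ C ∧ Function.Injective ψ ∧ (b' ≠ b ∨ x⁻¹ * x' ∉ 𝒢.branchSubgroup b v hb) ∧
      ∀ g ∈ C, (∀ i, ((𝒢.galoisLevelData h36).levelAct h36.isCountable (𝒢.galoisLevelData_hconn h36) i.1
            (MonoidHom.id _ g)).hom.vertexMap (w i) = w i ∧
          ((𝒢.galoisLevelData h36).levelAct h36.isCountable (𝒢.galoisLevelData_hconn h36) i.1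
            (MonoidHom.id _ g)).hom.branchMap (β i) = β i ∧
          ((𝒢.galoisLevelData h36).levelAct h36.isCountable (𝒢.galoisLevelData_hconn h36) i.1
            (MonoidHom.id _ g)).hom.branchMap (β' i) = β' i) →
        ιQ g ∈ ((𝒢.branchSubgroup b v hb).map (MulAut.conj x).toMonoidHom).map ψ ⊓
          ((𝒢.branchSubgroup b' v hb').map (MulAut.conj x').toMonoidHom).map ψ :=
  (𝒢.galoisLevelData h36).stabBranchPairCpt'_ofTower h36.isCountable (𝒢.galoisLevelData_hconn h36)
    (𝒢.temperedPiChart h36) (MonoidHom.id _) (𝒢.injOn_toLevelGal_temperedPiChart h36) hfaithV C hC j₀ w β β'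
    hpair hcompat

/-- **Compact-form finite-level data exist for the tempered fundamental group chart of every finite `𝒢`
satisfying the hypotheses of Thm. 3.7**: the Galois tower of Prop. 3.6 with its trees `𝔾̃_n`, finite levels
`𝔾_{S n}`, the identifications (I1)–(I3) and (I4′)_cpt, the latter's input (I0v) being seat abc-iut-L3-t6's
`galoisLevelData_faithfulV` — the rung-1 PRODUCER CONTRACT of the cell's ladder for Thm. 3.7 (iii),
DISCHARGED (the data are `finiteLevelDataCptOfTower` at the tower chart; stated as an existence so that this
file is proof-only). [cite: MochizukiSemiAnbd2006, Thm 3.7(iii) p.41] -/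
theorem exists_finiteLevelDataCpt_of_finite (h37 : 𝒢.Thm37Hypotheses) [Finite 𝒢.graph.Vertex]
    [Finite 𝒢.graph.Edge] : ∃ c₀ : TemperedPiChart 𝒢, Nonempty (FiniteLevelDataCpt.{0} 𝒢 c₀) :=
  ⟨𝒢.temperedPiChart h37.toProp36Hypotheses,
    ⟨(𝒢.galoisLevelData h37.toProp36Hypotheses).finiteLevelDataCptOfTower
      h37.toProp36Hypotheses.isCountable (𝒢.temperedPiChart h37.toProp36Hypotheses) (MonoidHom.id _)
      (𝒢.galoisLevelData_hconn h37.toProp36Hypotheses) (𝒢.galoisLevelData_isFinite h37.toProp36Hypotheses)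
      continuous_id fix_temperedPiChart stab_temperedPiChart edge_temperedPiChart
      (𝒢.stabBranchPairCpt'_temperedPiChart h37.toProp36Hypotheses (galoisLevelData_faithfulV 𝒢 h37))⟩⟩

/-- Compact-form finite-level data exist for EVERY chart of a finite `𝒢` satisfying the hypotheses of Thm. 3.7
(chart transport, seat abc-iut-w4-d064's `FiniteLevelDataCpt.nonempty_of_nonempty`).
[cite: MochizukiSemiAnbd2006, Thm 3.7(iii) p.41] -/
theorem nonempty_finiteLevelDataCpt_of_finite (h37 : 𝒢.Thm37Hypotheses) [Finite 𝒢.graph.Vertex]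
    [Finite 𝒢.graph.Edge] (c : TemperedPiChart 𝒢) : Nonempty (FiniteLevelDataCpt.{0} 𝒢 c) := by
  obtain ⟨c₀, h₀⟩ := 𝒢.exists_finiteLevelDataCpt_of_finite h37
  exact FiniteLevelDataCpt.nonempty_of_nonempty h₀ c

variable {𝒢}

/-- **[SemiAnbd] Theorem 3.7 (iii) at every FINITE `𝔾`** (`CompactInVerticialAt 𝒢`: under the hypotheses
of Thm. 3.7, for every chart `π₁^temp(𝒢)` and every compact `C ≤ π₁^temp(𝒢)`, `C` lies in a verticial
subgroup; if `C ≠ 1` lies in two distinct verticial subgroups then in no third, and then in an edge-like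
subgroup of a closed edge): the compact-form finite-level data of the constructed chart, transported to
every chart and consumed by `FiniteLevelDataCpt.compactInVerticial` (seat abc-iut-w4-d064's bridge
`compactInVerticialAt_of_finiteLevelDataCpt`). [cite: MochizukiSemiAnbd2006, Thm 3.7(iii) pp.40-41] -/
theorem compactInVerticialAt_of_finiteGraph [Finite 𝒢.graph.Vertex] [Finite 𝒢.graph.Edge] :
    CompactInVerticialAt 𝒢 := fun h37 =>
  compactInVerticialAt_of_finiteLevelDataCpt (𝒢.exists_finiteLevelDataCpt_of_finite h37) h37

/-- The same with explicit finiteness hypotheses (print p. 41: "the semi-graphs `𝔾_j` are all finite").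
[cite: MochizukiSemiAnbd2006, Thm 3.7(iii) pp.40-41] -/
theorem compactInVerticialAt_of_finiteGraph' (hV : Finite 𝒢.graph.Vertex) (hE : Finite 𝒢.graph.Edge) :
    CompactInVerticialAt 𝒢 :=
  compactInVerticialAt_of_finiteGraph

/-- **[SemiAnbd] Theorem 3.7 (iv) at every FINITE `𝔾`** ("The maximal compact subgroups of `π₁^temp(𝒢)`
are precisely the verticial subgroups. The nontrivial intersections of two distinct maximal compact
subgroups … are precisely the edge-like subgroups [of closed edges]"), from (iii) at `𝒢` by seat
abc-iut-L3-t11's reduction (Thm. 3.7 (i)/(ii) discharged in the tree).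
[cite: MochizukiSemiAnbd2006, Thm 3.7(iv) p.41] -/
theorem maximalCompactIffVerticialAt_of_finiteGraph [Finite 𝒢.graph.Vertex] [Finite 𝒢.graph.Edge] :
    MaximalCompactIffVerticialAt 𝒢 :=
  maximalCompactIffVerticialAt_of_compactInVerticialAt compactInVerticialAt_of_finiteGraph

/-- The rung-4 residual at every FINITE `𝔾`: every nontrivial edge-like subgroup of a closed edge is the
intersection of two distinct verticial subgroups. [cite: MochizukiSemiAnbd2006, Thm 3.7(iv) p.41] -/
theorem edgeLikeIsInfVerticialAt_of_finiteGraph [Finite 𝒢.graph.Vertex] [Finite 𝒢.graph.Edge] :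
    EdgeLikeIsInfVerticialAt 𝒢 :=
  edgeLikeIsInfVerticialAt_of_compactInVerticialAt compactInVerticialAt_of_finiteGraph

/-- `EdgeLikeDistinct` at every FINITE `𝔾`. [cite: MochizukiSemiAnbd2006, Thm 3.7(iv) p.41] -/
theorem edgeLikeDistinctAt_of_finiteGraph [Finite 𝒢.graph.Vertex] [Finite 𝒢.graph.Edge] :
    EdgeLikeDistinctAt 𝒢 :=
  edgeLikeDistinctAt_of_compactInVerticialAt compactInVerticialAt_of_finiteGraph

end ProfiniteSemiGraph

end Literature.AnabelianGeometry.SemiGraphs
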